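import Summits.QuantumFields.YangMills.Theorems.BalabanLadderIRDefectSquaring
import HarnessLib

/-!
# Abstract purity basin — negative-side anchors of the counterexample scan of `stub_abstractBasin36` (cscan ym-ir-cscan-basin64 g0)

Director-ym R403∕R406 unit `ym-ir-cscan-basin64` (refuter, explicit-unit): COUNTEREXAMPLE SCAN of
`stub_abstractBasin36 : AbstractBasin (1/2^3) (1/24)` (line `basin-transfer`, `Cruxes/IR/Lines/basin_transfer.lean` rev 8, ideator
ym-ir-idea-9; crux `BalabanLadder.IR`, stmt-QuantumFields-19354).  OUTCOME OF THE SCAN: NO KILL (memo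
`pub/ym-ir/ym-ir-cscan-basin64/MEMO-cscan-abstractBasin36.md`); this file lands the two kernel facts the memo's no-go arguments rest on.
They are HELPERS about the abstract `[Sym]+[TM]` class (no Theses statement is asserted or denied):

* `mul_phi_le_mul_phi` ∕ `casimirSlope_nonneg` ∕ `exp_mul_phi_le` — **the Casimir slope is non-negative**: for `2 ≤ n ≤ n'` and every
  cross-section `(b₁,b₂)`, `n·φ(Z n' b₁ b₂) ≤ n'·φ(Z n b₁ b₂)` (`φ = log λ₀`, `DefectSquaringOneBox.phi`).  Equivalently the abstract
  ground-energy density `−φ(Z n b₁ b₂)/(n b₁ b₂)` is non-decreasing when a side is enlarged: Casimir energy is `≤ 0` and its density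
  shrinks under dilation, for EVERY axis-symmetric trace-positive family (the lattice analogue of the CFT statement of
  Belin–de Boer–Kruthoff–Michel–Shaghoulian–Shyani, JHEP03(2017)067 §4.1, arXiv:1610.06186 p. 8).  Proof: ℓᵖ-monotonicity
  `mul_log_le` of the transposed box at every time, axis symmetry `(0 3)`, limit `c → ∞` (`tendsto_phi`).  Consequently the
  `c·slope` term of `DefectSquaring.extension_step` is always a cost, and a «pure vacuum + positive-Casimir excitations» design
  `Z = e^{−κV} + Z₁` can never be a counterexample (memo §3 F3).
* `Yfun_transpose` ∕ `Yfun_slab_le_cube` — **crossed-channel identity**: `Y_t(n,b₁,b₂) = Y_n(t,b₁,b₂) + t·((n/t)φ(t,b₁,b₂) − φ(n,b₁,b₂))`,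
  hence `Y_n(t,b₁,b₂) ≤ Y_t(n,b₁,b₂)` for `2 ≤ t ≤ n`: the long-time excess of the slab `(t,b₁,b₂)` never exceeds the thermal excess of
  the box `(n,b₁,b₂)` at time `t`.  With `n = L`, `t = ⌊L/4⌋`, `b₁ = b₂ = L` this is the two-channel form of the cube defect used in the
  memo (§3 F2): `1 − δ(L) = exp{Y_L(2t,L,L) − 2Y_L(t,L,L) − L·(2φ(t,L,L) − φ(2t,L,L))}` with the last bracket `≥ 0`.

HONEST FRAMING.  Nothing here proves or refutes the Yang–Mills mass gap (Clay), a lattice gap, `BalabanLadder.IR` or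
`stub_abstractBasin36`; IR stays 0∕1; these are elementary structural facts of the abstract basin class, `--supports` the crux item.
-/

open Filter Topology

namespace Summit.QuantumFields.YangMills.Cruxes.IR.AspectBootstrap.CasimirSlope

/-- `log z(m)/m → φ(z)` for a spectral datum. -/
theorem tendsto_phi {z : ℕ → ℝ} (h : HasSpectralDatum z) :
    Tendsto (fun m : ℕ => Real.log (z (m + 2)) / ((m : ℝ) + 2)) atTop (𝓝 (phi z)) := by
  obtain ⟨ι, lam, i₀, hle, hpos, hsum⟩ := h
  rw [phi_eq_log hle hpos hsum]
  exact tendsto_log_div hle hpos hsum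

variable {Z : ℕ → ℕ → ℕ → ℕ → ℝ}

/-- **Casimir slope ≥ 0** (abstract Casimir energy is non-positive and its density is monotone under dilation):
for `2 ≤ n ≤ n'`, `n · φ(Z n' b₁ b₂) ≤ n' · φ(Z n b₁ b₂)`.  Proof: ℓᵖ-monotonicity `n log Z(c,b,n') ≤ n' log Z(c,b,n)`
of the transposed box `(c,b₁,b₂)` at every time `c`, axis symmetry `(0 3)`, divide by `c`, let `c → ∞`. -/
theorem mul_phi_le_mul_phi (hS : IsAxisSymmetric Z) (hT : IsTracePositive Z) {b₁ b₂ n n' : ℕ}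
    (hb₁ : 2 ≤ b₁) (hb₂ : 2 ≤ b₂) (hn : 2 ≤ n) (hnn' : n ≤ n') :
    (n : ℝ) * phi (Z n' b₁ b₂) ≤ (n' : ℝ) * phi (Z n b₁ b₂) := by
  obtain ⟨kn, rfl⟩ : ∃ kn, n = kn + 2 := ⟨n - 2, by omega⟩
  obtain ⟨kn', rfl⟩ : ∃ kn', n' = kn' + 2 := ⟨n' - 2, by omega⟩
  have hdn : HasSpectralDatum (Z (kn + 2) b₁ b₂) := hT _ _ _ (by omega) hb₁ hb₂
  have hdn' : HasSpectralDatum (Z (kn' + 2) b₁ b₂) := hT _ _ _ (by omega) hb₁ hb₂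
  have key : ∀ kc : ℕ, ((kn + 2 : ℕ) : ℝ) * (Real.log (Z (kn' + 2) b₁ b₂ (kc + 2)) / ((kc : ℝ) + 2)) ≤
      ((kn' + 2 : ℕ) : ℝ) * (Real.log (Z (kn + 2) b₁ b₂ (kc + 2)) / ((kc : ℝ) + 2)) := by
    intro kc
    have hw : HasSpectralDatum (Z (kc + 2) b₁ b₂) := hT _ _ _ (by omega) hb₁ hb₂
    have h1 := mul_log_le hw (show kn ≤ kn' by omega)
    have A3 : Z (kn + 2) b₁ b₂ (kc + 2) = Z (kc + 2) b₁ b₂ (kn + 2) := (hS _ _ _ _).1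
    have A3' : Z (kn' + 2) b₁ b₂ (kc + 2) = Z (kc + 2) b₁ b₂ (kn' + 2) := (hS _ _ _ _).1
    rw [← A3, ← A3'] at h1
    have hc : (0 : ℝ) ≤ (kc : ℝ) + 2 := by positivity
    rw [← mul_div_assoc, ← mul_div_assoc]
    exact div_le_div_of_nonneg_right h1 hc
  have t1 := (tendsto_phi hdn').const_mul (((kn + 2 : ℕ) : ℝ))
  have t2 := (tendsto_phi hdn).const_mul (((kn' + 2 : ℕ) : ℝ))
  exact le_of_tendsto_of_tendsto' t1 t2 key

/-- Slope form: `0 ≤ (n'/n) φ(n,b₁,b₂) − φ(n',b₁,b₂)` for `2 ≤ n ≤ n'` (the `c · slope` term of `extension_step`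
is a COST, never a gain). -/
theorem casimirSlope_nonneg (hS : IsAxisSymmetric Z) (hT : IsTracePositive Z) {b₁ b₂ n n' : ℕ}
    (hb₁ : 2 ≤ b₁) (hb₂ : 2 ≤ b₂) (hn : 2 ≤ n) (hnn' : n ≤ n') :
    0 ≤ ((n' : ℝ) / n) * phi (Z n b₁ b₂) - phi (Z n' b₁ b₂) := by
  have h := mul_phi_le_mul_phi hS hT hb₁ hb₂ hn hnn'
  have hnpos : (0 : ℝ) < n := by exact_mod_cast (show 0 < n by omega)
  rw [sub_nonneg, div_mul_eq_mul_div, le_div_iff₀ hnpos, mul_comm]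
  linarith

/-- Top-eigenvalue form: `λ₀(n',b₁,b₂)^n ≤ λ₀(n,b₁,b₂)^{n'}`, i.e. `e^{n φ(n')} ≤ e^{n' φ(n)}`. -/
theorem exp_mul_phi_le (hS : IsAxisSymmetric Z) (hT : IsTracePositive Z) {b₁ b₂ n n' : ℕ}
    (hb₁ : 2 ≤ b₁) (hb₂ : 2 ≤ b₂) (hn : 2 ≤ n) (hnn' : n ≤ n') :
    Real.exp ((n : ℝ) * phi (Z n' b₁ b₂)) ≤ Real.exp ((n' : ℝ) * phi (Z n b₁ b₂)) :=
  Real.exp_le_exp.2 (mul_phi_le_mul_phi hS hT hb₁ hb₂ hn hnn')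

/-- **Crossed-channel identity**: reading the box `(n,b₁,b₂) × t` along its first axis,
`Y_t(n,b₁,b₂) = Y_n(t,b₁,b₂) + t · ((n/t) φ(t,b₁,b₂) − φ(n,b₁,b₂))` — thermal excess at time `t` = long-time excess of
the transposed slab + `t ×` the Casimir slope `t → n`. -/
theorem Yfun_transpose (hS : IsAxisSymmetric Z) {b₁ b₂ t n : ℕ} (ht : 2 ≤ t) :
    Yfun (Z n b₁ b₂) t = Yfun (Z t b₁ b₂) n + (t : ℝ) * (((n : ℝ) / t) * phi (Z t b₁ b₂) - phi (Z n b₁ b₂)) := by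
  have A3 : Z n b₁ b₂ t = Z t b₁ b₂ n := (hS _ _ _ _).1
  have htpos : (t : ℝ) ≠ 0 := by exact_mod_cast (show t ≠ 0 by omega)
  unfold Yfun
  rw [A3]
  field_simp
  ring

/-- **The cube dominates its slab** (crossed channel + Casimir slope ≥ 0): for `2 ≤ t ≤ n`,
`Y_n(t,b₁,b₂) ≤ Y_t(n,b₁,b₂)` — e.g. the long-time (`L`) excess of the quarter-slab `(⌊L/4⌋, L, L)` is at most the
thermal excess of the cube `L³` at time `⌊L/4⌋`; a counterexample's impurity can come from slab quasi-degeneracy OR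
from a positive Casimir slope, never from a negative one. -/
theorem Yfun_slab_le_cube (hS : IsAxisSymmetric Z) (hT : IsTracePositive Z) {b₁ b₂ t n : ℕ}
    (hb₁ : 2 ≤ b₁) (hb₂ : 2 ≤ b₂) (ht : 2 ≤ t) (htn : t ≤ n) :
    Yfun (Z t b₁ b₂) n ≤ Yfun (Z n b₁ b₂) t := by
  rw [Yfun_transpose hS ht (n := n)]
  have h := casimirSlope_nonneg hS hT hb₁ hb₂ ht htn
  have htpos : (0 : ℝ) ≤ t := by positivity
  nlinarith

end Summit.QuantumFields.YangMills.Cruxes.IR.AspectBootstrap.CasimirSlope
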